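import Mathlib
import Literature.MathematicalPhysics.QuantumManyBody.BoseEinsteinCondensation
import Summits.AtomisticToContinuum.BoseEinsteinCondensation.Theorems.SoloBlindBhattacharyya

/-!
# The converse half: occupation of any mode is bounded by the affinity of its modulus

Solo seat `solo-AtomisticToContinuum-blind`, conjunct `BoseEinsteinCondensation`.

For a nonnegative `(n+1)`-particle amplitude `Φ` and **any** normalised (complex, a.e. strongly
measurable) mode `φ`, the occupation `⟨φ, γ_Φ φ⟩` is at most `(n+1)` times the Bhattacharyya
affinity of the resampling by `|φ|²`:
`occupation (n+1) φ Φ ≤ (n+1) · ∫_Y (∫ₓ |φ x| Φ(x::Y)) (∫ₓ Φ(x::Y)²)^{1/2}`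
(`occupation_le_mul_affinity_norm`).  Consequently
`maxOccupation (n+1) Φ ≤ (n+1) · b` whenever every nonnegative normalised mode has affinity `≤ b`
(`maxOccupation_le_mul_of_affinity_le`).  Together with the lower half
`(n+1) · BC(g)² ≤ maxOccupation` (`bhattacharyya_sq_le_maxOccupation'`) this makes
**macroscopic occupation ⟺ non-vanishing affinity** a two-sided kernel statement for nonnegative
amplitudes: `(n+1) sup_g BC(g)² ≤ maxOccupation (n+1) Φ ≤ (n+1) sup_g BC(g)`.

Proof: replace `φ` by a measurable modification (the inner Bochner integrals do not change),
bound `‖∫ conj φ · Φ‖ ≤ ∫ |φ| Φ` (`Φ ≥ 0`), and apply the Cauchy–Schwarz half of the sandwich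
(`modeWeight_le_bhattacharyya`) to the nonnegative mode `|φ|`.
-/

open MeasureTheory
open scoped ENNReal

namespace Summit.AtomisticToContinuum.BoseEinsteinCondensation.Theorems

open Literature.MathematicalPhysics.QuantumManyBody.BoseGas

/-- **Occupation ≤ (n+1) · affinity of the modulus**, for nonnegative real amplitudes and arbitrary
normalised modes. -/
theorem occupation_le_mul_affinity_norm {n : ℕ} {φ : Space → ℂ} {Φ : Config (n + 1) → ℝ}
    (hΦ0 : 0 ≤ Φ) (hΦm : Measurable Φ) (hφm : AEStronglyMeasurable φ volume)
    (hφ1 : ∫⁻ x, (‖φ x‖₊ : ℝ≥0∞) ^ 2 = 1) :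
    occupation (n + 1) φ (fun X => (Φ X : ℂ)) ≤
      (n + 1 : ℝ≥0∞) * ∫⁻ Y : Config n,
        (∫⁻ x, ENNReal.ofReal ‖hφm.mk φ x‖ * ENNReal.ofReal (Φ (Matrix.vecCons x Y))) *
          (∫⁻ x, ENNReal.ofReal (Φ (Matrix.vecCons x Y)) ^ 2) ^ (1 / 2 : ℝ) := by
  set φ' : Space → ℂ := hφm.mk φ with hφ'
  have hφ'm : Measurable φ' := hφm.stronglyMeasurable_mk.measurable
  have hae : φ =ᵐ[volume] φ' := hφm.ae_eq_mk
  -- Step 1: replace `φ` by its measurable modification inside the Bochner integrals.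
  have hocc : occupation (n + 1) φ (fun X => (Φ X : ℂ)) =
      (n + 1 : ℝ≥0∞) * ∫⁻ Y : Config n,
        (‖∫ x, (starRingEnd ℂ) (φ' x) * (Φ (Matrix.vecCons x Y) : ℂ)‖₊ : ℝ≥0∞) ^ 2 := by
    simp only [occupation]
    congr 1
    refine lintegral_congr fun Y => ?_
    congr 3
    refine integral_congr_ae ?_
    filter_upwards [hae] with x hx
    rw [hx]
  rw [hocc]
  gcongr with Y
  -- Step 2: `‖∫ conj φ' · Φ‖ₑ ≤ ∫ |φ'| Φ` and Cauchy–Schwarz.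
  have hΦY : Measurable fun x => ENNReal.ofReal (Φ (Matrix.vecCons x Y)) :=
    ENNReal.measurable_ofReal.comp (hΦm.comp (measurable_vecCons.comp
      (measurable_id.prodMk measurable_const)))
  have hg : Measurable fun x => ENNReal.ofReal ‖φ' x‖ :=
    ENNReal.measurable_ofReal.comp hφ'm.norm
  have hg1 : ∫⁻ x, ENNReal.ofReal ‖φ' x‖ ^ 2 ≤ 1 := by
    rw [← hφ1]
    refine (lintegral_congr_ae ?_).le
    filter_upwards [hae] with x hx
    rw [hx, ofReal_norm]
    rfl
  have h1 : (‖∫ x, (starRingEnd ℂ) (φ' x) * (Φ (Matrix.vecCons x Y) : ℂ)‖₊ : ℝ≥0∞) ≤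
      ∫⁻ x, ENNReal.ofReal ‖φ' x‖ * ENNReal.ofReal (Φ (Matrix.vecCons x Y)) := by
    refine (enorm_integral_le_lintegral_enorm _).trans (le_of_eq ?_)
    refine lintegral_congr fun x => ?_
    rw [enorm_mul, RCLike.enorm_conj, ← ofReal_norm, ← ofReal_norm, Complex.norm_real,
      Real.norm_of_nonneg (hΦ0 _)]
  calc (‖∫ x, (starRingEnd ℂ) (φ' x) * (Φ (Matrix.vecCons x Y) : ℂ)‖₊ : ℝ≥0∞) ^ 2
      ≤ (∫⁻ x, ENNReal.ofReal ‖φ' x‖ * ENNReal.ofReal (Φ (Matrix.vecCons x Y))) ^ 2 :=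
        pow_le_pow_left' h1 2
    _ = (∫⁻ x, ENNReal.ofReal ‖φ' x‖ * ENNReal.ofReal (Φ (Matrix.vecCons x Y))) *
          (∫⁻ x, ENNReal.ofReal ‖φ' x‖ * ENNReal.ofReal (Φ (Matrix.vecCons x Y))) := sq _
    _ ≤ (∫⁻ x, ENNReal.ofReal ‖φ' x‖ * ENNReal.ofReal (Φ (Matrix.vecCons x Y))) *
          (∫⁻ x, ENNReal.ofReal (Φ (Matrix.vecCons x Y)) ^ 2) ^ (1 / 2 : ℝ) := by
        gcongr
        exact lintegral_mul_le_sqrt volume hg.aemeasurable hΦY.aemeasurable hg1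

/-- **The converse half of the criterion.** If every nonnegative normalised measurable mode `g`
has affinity `≤ b` with respect to the nonnegative amplitude `Φ`, then
`maxOccupation (n+1) Φ ≤ (n+1) · b`: macroscopic occupation of *some* mode forces non-vanishing
affinity for *some* nonnegative mode. -/
theorem maxOccupation_le_mul_of_affinity_le {n : ℕ} {Φ : Config (n + 1) → ℝ}
    (hΦ0 : 0 ≤ Φ) (hΦm : Measurable Φ) {b : ℝ≥0∞}
    (hb : ∀ g : Space → ℝ, 0 ≤ g → Measurable g → ∫⁻ x, ENNReal.ofReal (g x) ^ 2 = 1 →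
      ∫⁻ Y : Config n, (∫⁻ x, ENNReal.ofReal (g x) * ENNReal.ofReal (Φ (Matrix.vecCons x Y))) *
        (∫⁻ x, ENNReal.ofReal (Φ (Matrix.vecCons x Y)) ^ 2) ^ (1 / 2 : ℝ) ≤ b) :
    maxOccupation (n + 1) (fun X => (Φ X : ℂ)) ≤ (n + 1 : ℝ≥0∞) * b := by
  refine iSup₂_le fun φ hφ => ?_
  obtain ⟨hφm, hφ1⟩ := hφ
  refine (occupation_le_mul_affinity_norm hΦ0 hΦm hφm hφ1).trans (mul_le_mul' le_rfl ?_)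
  refine hb (fun x => ‖hφm.mk φ x‖) (fun x => norm_nonneg _)
    hφm.stronglyMeasurable_mk.measurable.norm ?_
  rw [← hφ1]
  refine lintegral_congr_ae ?_
  filter_upwards [hφm.ae_eq_mk] with x hx
  rw [hx, ofReal_norm]
  rfl

end Summit.AtomisticToContinuum.BoseEinsteinCondensation.Theorems
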